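import Summits.HodgeConjecture.CorCM.IrreducibleOddWeightsRightIdealsPivotFamiliesCMFields
import HarnessLib

/-!
# Right ideals, VII: an imaginary QUADRATIC pivot — shadows are odd, the Hecke modules are lines, and
# `Σ_i dim Hg(A_i) − dim Hg(∏_i A_i) = #{i : d_i ≠ 0} − 1` (pairs: the drop is EXACTLY `1` when both defects are non-zero)

COR-CM (cell `pub-hodgecm2`, binder seat `b16` gen 64, count-neutral claim RIGHT IDEALS, file R7 — CM fields; theorems only,
no definition, no named fact, no `sorry`).  NEW as stated, hence under `Summits/`.  HONEST FRAMING: exact values of the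
codimension of `Hg(∏_i A_i)` in `∏_i Hg(A_i)` for CM fields sharing an imaginary quadratic field `k`, sharpening gen 62's
`IrreducibleOddWeightsOrbitBalanceQuadraticPairs` (additive iff one signature defect vanishes) and the tree's
`SharedImaginaryQuadraticDegenerate` (both non-zero ⟹ strict drop); `HC_CM` is neither used nor asserted.

SETTING (R4/R5b).  CM fields `K_i`, CM types `Φ_i`, `j_i : k → K_i`, `z₀ : k → ℂ`; the shadow at `z₀`,
`W_i = Σ_{t | t∘j_i = z₀} u_1(Φ_i)(t) = #{t ∈ Φ_i over z₀} − #{t ∈ Φ_i over z̄₀} = d_i`, the SIGNATURE DEFECT of `Φ_i` on `k`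
(`shadow_at_eq_sum_ksign`: it is gen 62's `Σ_{φ ∈ Φ_i} sign(φ|_k)`).

* §1 (any pivot `M`, any CM field) **`shadow_conjugate`** — shadows are ODD: `w(z̄) = −w(z)`; hence every element of a Hecke
  module `H = span{w(· ∘ δ)}` is odd (`apply_conjugate_eq_neg_of_mem_span_precomp_shadow`).
* §2 (`[k:ℚ] = 2`, `k` totally complex) odd functions on `Hom(k, ℂ) = {z₀, z̄₀}` are determined by their value at `z₀`, so
  every Hecke module — and any sum of them — has dimension `≤ 1` (`finrank_le_one_of_forall_apply_conjugate`), and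
  **`finrank_span_precomp_shadow_eq`**: `dim H_i = [W_i ≠ 0]`; `finrank_iSup_span_precomp_shadow_eq`: `dim Σ_i H_i = [∃ i, W_i ≠ 0]`.
* §3 THE EXACT COUNTS (Galois closures meeting inside `z₀(k)`):
  **`cmTypeRank_add_cmTypeRank_eq_of_quadratic`** — `cmTypeRank Φ₀ + cmTypeRank Φ₁ = cmFamilyRank Φ + 1 + [W₀ ≠ 0 ∧ W₁ ≠ 0]`:
  **`dim Hg(A₀) + dim Hg(A₁) − dim Hg(A₀ × A₁)` is EXACTLY `1` when both signature defects are non-zero and `0` otherwise**;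
  **`sum_cmTypeRank_add_one_add_eq_of_quadratic`** — for a family under (GL):
  `Σ_i cmTypeRank Φ_i + 1 + [∃ i, W_i ≠ 0] = cmFamilyRank Φ + |I| + #{i : W_i ≠ 0}`, i.e.
  **`Σ_i dim Hg(A_i) − dim Hg(∏_i A_i) = #{i : d_i ≠ 0} − 1`** as soon as one defect is non-zero: every member of Weil type over `k`
  beyond the first costs exactly one dimension.

## References

* [MoonenZarhin1999LowDim] B. Moonen, Yu. Zarhin, *Hodge classes on abelian varieties of low dimension*, Math. Ann. 315
  (1999), Thm. (0.1) (a), §3 (3.1).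
* [Gordon1999HodgeAVSurvey] B. B. Gordon, *A survey of the Hodge conjecture for abelian varieties*, §3 Theorem (proof),
  7.5–7.7, 9.4.3.
* [Deligne1982HodgeCycles] P. Deligne, *Hodge cycles on abelian varieties*, LNM 900 (1982), §4 (Weil classes), I.5.
* [Shimura1998] G. Shimura, *Abelian Varieties with Complex Multiplication and Modular Functions*, §18.1.
-/

set_option autoImplicit false

noncomputable section

open scoped BigOperators Classical

open CategoryTheory CategoryTheory.Limits NumberField NumberField.ComplexEmbedding Module IntermediateField

namespace Summit.HodgeConjecture.CorCM

open Literature.NumberTheory.ComplexMultiplication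
open Literature.AlgebraicGeometry.Motives (AbelianVariety CMType)
open Literature.AlgebraicGeometry.Pohlmann1968

/-! ### §1 Shadows are odd -/

section Odd

variable {K : Type} [Field K] [NumberField K] {M : Type} [Field M] [NumberField M]

omit [NumberField K] in
/-- `u_1(Φ)(t̄) = −u_1(Φ)(t)` for a CM type. [cite: Shimura1998, §18.1] -/
theorem antiVec_one_conjugate (Φ : CMType K) (t : K →+* ℂ) :
    antiVec Φ.1 (1 : ℂ ≃+* ℂ) (conjugate t) = -antiVec Φ.1 (1 : ℂ ≃+* ℂ) t := by
  simp only [antiVec]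
  by_cases ht : t ∈ Φ.1
  · rw [translateInd_of_mem (show (1 : ℂ ≃+* ℂ) • t ∈ Φ.1 by rwa [one_smul]),
      translateInd_of_not_mem (show ¬(1 : ℂ ≃+* ℂ) • conjugate t ∈ Φ.1 by rw [one_smul]; exact (Φ.2 t).1 ht)]
    norm_num
  · have hc : conjugate t ∈ Φ.1 := by
      by_contra hc
      exact ht ((Φ.2 t).2 hc)
    rw [translateInd_of_not_mem (show ¬(1 : ℂ ≃+* ℂ) • t ∈ Φ.1 by rwa [one_smul]),
      translateInd_of_mem (show (1 : ℂ ≃+* ℂ) • conjugate t ∈ Φ.1 by rwa [one_smul])]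
    norm_num

omit [NumberField M] in
/-- **SHADOWS ARE ODD: `w(z̄) = −w(z)`** — `t ↦ t̄` is a bijection from the fibre of `z̄` onto the fibre of `z` reversing
the sign of `u_1(Φ)`. [cite: Shimura1998, §18.1] [cite: Deligne1982HodgeCycles, §4] -/
theorem shadow_conjugate (Φ : CMType K) (j : M →+* K) (z : M →+* ℂ) :
    ∑ t ∈ Finset.univ.filter (fun t : K →+* ℂ => t.comp j = conjugate z), antiVec Φ.1 (1 : ℂ ≃+* ℂ) t =
      -∑ t ∈ Finset.univ.filter (fun t : K →+* ℂ => t.comp j = z), antiVec Φ.1 (1 : ℂ ≃+* ℂ) t := by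
  rw [Finset.sum_filter, Finset.sum_filter, ← Finset.sum_neg_distrib]
  refine Fintype.sum_equiv (Function.Involutive.toPerm _ (involutive_conjugate K)) _ _ fun t => ?_
  rw [Function.Involutive.coe_toPerm]
  have hiff : t.comp j = conjugate z ↔ (conjugate t).comp j = z := by
    rw [conjugate_comp]
    constructor
    · intro h; rw [h, (involutive_conjugate M) z]
    · intro h; rw [← h, (involutive_conjugate M) (t.comp j)]
  by_cases h : t.comp j = conjugate z
  · rw [if_pos h, if_pos (hiff.1 h), antiVec_one_conjugate, neg_neg]
  · rw [if_neg h, if_neg (fun h' => h (hiff.2 h')), neg_zero]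

/-- **Every element of the Hecke module of a shadow is odd**: `f(z̄) = −f(z)` for `f ∈ span{w(· ∘ δ) : δ}`.
[cite: Shimura1998, §18.1] -/
theorem apply_conjugate_eq_neg_of_mem_span_precomp_shadow (Φ : CMType K) (j : M →+* K) {f : (M →+* ℂ) → ℚ}
    (hf : f ∈ Submodule.span ℚ (Set.range fun δ : M ≃ₐ[ℚ] M => fun z : M →+* ℂ =>
      ∑ t ∈ Finset.univ.filter (fun t : K →+* ℂ => t.comp j = z.comp (δ : M →+* M)), antiVec Φ.1 (1 : ℂ ≃+* ℂ) t))
    (z : M →+* ℂ) : f (conjugate z) = -f z := by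
  induction hf using Submodule.span_induction with
  | mem _ h =>
    obtain ⟨δ, rfl⟩ := h
    change ∑ t ∈ Finset.univ.filter (fun t : K →+* ℂ => t.comp j = (conjugate z).comp (δ : M →+* M)),
        antiVec Φ.1 (1 : ℂ ≃+* ℂ) t = -∑ t ∈ Finset.univ.filter (fun t : K →+* ℂ =>
          t.comp j = z.comp (δ : M →+* M)), antiVec Φ.1 (1 : ℂ ≃+* ℂ) t
    rw [conjugate_comp, shadow_conjugate]
  | zero => simp
  | add _ _ _ _ h₁ h₂ => simp only [Pi.add_apply, h₁, h₂, neg_add]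
  | smul a _ _ h₁ => simp only [Pi.smul_apply, h₁, smul_eq_mul, mul_neg]

variable {I : Type} {K' : I → Type} [∀ i, Field (K' i)] [∀ i, NumberField (K' i)]

/-- … and so is every element of a SUM of Hecke modules of shadows. [cite: Shimura1998, §18.1] -/
theorem apply_conjugate_eq_neg_of_mem_iSup_span_precomp_shadow (Φ : ∀ i, CMType (K' i)) (j : ∀ i, M →+* K' i)
    {f : (M →+* ℂ) → ℚ}
    (hf : f ∈ ⨆ i, Submodule.span ℚ (Set.range fun δ : M ≃ₐ[ℚ] M => fun z : M →+* ℂ =>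
      ∑ t ∈ Finset.univ.filter (fun t : K' i →+* ℂ => t.comp (j i) = z.comp (δ : M →+* M)),
        antiVec (Φ i).1 (1 : ℂ ≃+* ℂ) t))
    (z : M →+* ℂ) : f (conjugate z) = -f z := by
  induction hf using Submodule.iSup_induction' with
  | mem i f hf => exact apply_conjugate_eq_neg_of_mem_span_precomp_shadow (Φ i) (j i) hf z
  | zero => simp
  | add f g _ _ h₁ h₂ => simp only [Pi.add_apply, h₁, h₂, neg_add]

end Odd

/-! ### §2 An imaginary quadratic pivot: the Hecke modules are lines -/

section Quadratic

variable {K : Type} [Field K] [NumberField K] {k : Type} [Field k] [NumberField k] [IsTotallyComplex k]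

omit [NumberField k] in
/-- No embedding of a totally complex field is real. [folklore] -/
theorem conjugate_ne_self_of_isTotallyComplex (z : k →+* ℂ) : conjugate z ≠ z := fun h =>
  IsTotallyComplex.complexEmbedding_not_isReal z (ComplexEmbedding.isReal_iff.2 h)

/-- An imaginary quadratic field has exactly the two embeddings `z₀`, `z̄₀`. [cite: Shimura1998, §18.1] -/
theorem eq_or_eq_conjugate_of_finrank_eq_two' (hk : finrank ℚ k = 2) (z₀ z : k →+* ℂ) :
    z = z₀ ∨ z = conjugate z₀ := by
  by_contra h
  push Not at h
  have hle : ({z₀, conjugate z₀, z} : Finset (k →+* ℂ)).card ≤ 2 := by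
    rw [← hk, ← Embeddings.card k ℂ]
    exact Finset.card_le_univ _
  have h3 : ({z₀, conjugate z₀, z} : Finset (k →+* ℂ)).card = 3 := by
    rw [Finset.card_insert_of_notMem, Finset.card_pair fun h' => h.2 h'.symm]
    simp only [Finset.mem_insert, Finset.mem_singleton, not_or]
    exact ⟨(conjugate_ne_self_of_isTotallyComplex z₀).symm, fun h' => h.1 h'.symm⟩
  omega

/-- **Odd functions on `Hom(k, ℂ) = {z₀, z̄₀}` form at most a line**: a submodule all of whose elements satisfy
`f(z̄) = −f(z)` has dimension `≤ 1` (evaluation at `z₀` is injective on it). [folklore] -/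
theorem finrank_le_one_of_forall_apply_conjugate (hk : finrank ℚ k = 2) (z₀ : k →+* ℂ)
    (S : Submodule ℚ ((k →+* ℂ) → ℚ)) (hS : ∀ f ∈ S, ∀ z, f (conjugate z) = -f z) :
    Module.finrank ℚ S ≤ 1 := by
  let ev : S →ₗ[ℚ] ℚ := (LinearMap.proj z₀ : ((k →+* ℂ) → ℚ) →ₗ[ℚ] ℚ) ∘ₗ S.subtype
  have hinj : Function.Injective ev := by
    intro f g hfg
    apply Subtype.ext
    funext z
    have h0 : (f : (k →+* ℂ) → ℚ) z₀ = (g : (k →+* ℂ) → ℚ) z₀ := hfg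
    rcases eq_or_eq_conjugate_of_finrank_eq_two' hk z₀ z with rfl | rfl
    · exact h0
    · rw [hS f f.2 z₀, hS g g.2 z₀, h0]
  have h := LinearMap.finrank_le_finrank_of_injective hinj
  rwa [Module.finrank_self] at h

/-- **The shadow at `z₀` is the signature defect**: `Σ_{t | t∘j = z₀} u_1(Φ)(t) = Σ_{φ ∈ Φ} sign(φ|_k)` (gen 62's `d`), both
being `#{t ∈ Φ over z₀} − #{t ∈ Φ over z̄₀}`. [cite: Gordon1999HodgeAVSurvey, 9.4.3] [cite: Deligne1982HodgeCycles, §4] -/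
theorem shadow_at_eq_sum_ksign (hk : finrank ℚ k = 2) (Φ : CMType K) (j : k →+* K) (z₀ : k →+* ℂ) :
    ∑ t ∈ Finset.univ.filter (fun t : K →+* ℂ => t.comp j = z₀), antiVec Φ.1 (1 : ℂ ≃+* ℂ) t =
      ∑ φ ∈ Finset.univ.filter (fun φ : K →+* ℂ => φ ∈ Φ.1), (if φ.comp j = z₀ then (1 : ℚ) else -1) := by
  -- both sides as sums over all `t`
  rw [Finset.sum_filter, Finset.sum_filter]
  -- `Σ_t [t over z₀]·u(t) = Σ_{t ∈ Φ over z₀} 1 − Σ_{t ∉ Φ over z₀} 1` and `t ↦ t̄` maps `{t ∉ Φ over z₀}` onto `{t ∈ Φ over z̄₀}`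
  have h1 : ∀ t : K →+* ℂ, (if t.comp j = z₀ then antiVec Φ.1 (1 : ℂ ≃+* ℂ) t else 0) =
      (if t ∈ Φ.1 then (if t.comp j = z₀ then (1 : ℚ) else 0) else 0) -
        (if conjugate t ∈ Φ.1 then (if (conjugate t).comp j = conjugate z₀ then (1 : ℚ) else 0) else 0) := by
    intro t
    have hiff : (conjugate t).comp j = conjugate z₀ ↔ t.comp j = z₀ := by
      rw [conjugate_comp]
      exact (involutive_conjugate k).injective.eq_iff
    simp only [hiff, antiVec]
    by_cases ht : t ∈ Φ.1
    · have hct : conjugate t ∉ Φ.1 := (Φ.2 t).1 ht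
      rw [translateInd_of_mem (show (1 : ℂ ≃+* ℂ) • t ∈ Φ.1 by rwa [one_smul])]
      simp only [ht, hct, if_true, if_false, sub_zero]
      split_ifs <;> norm_num
    · have hct : conjugate t ∈ Φ.1 := by
        by_contra hc
        exact ht ((Φ.2 t).2 hc)
      rw [translateInd_of_not_mem (show ¬(1 : ℂ ≃+* ℂ) • t ∈ Φ.1 by rwa [one_smul])]
      simp only [ht, hct, if_true, if_false, zero_sub]
      split_ifs <;> norm_num
  have h2 : ∀ φ : K →+* ℂ, (if φ ∈ Φ.1 then (if φ.comp j = z₀ then (1 : ℚ) else -1) else 0) =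
      (if φ ∈ Φ.1 then (if φ.comp j = z₀ then (1 : ℚ) else 0) else 0) -
        (if φ ∈ Φ.1 then (if φ.comp j = conjugate z₀ then (1 : ℚ) else 0) else 0) := by
    intro φ
    by_cases hφ : φ ∈ Φ.1
    · simp only [hφ, if_true]
      rcases eq_or_eq_conjugate_of_finrank_eq_two' hk z₀ (φ.comp j) with h | h
      · have hne : φ.comp j ≠ conjugate z₀ := by
          rw [h]; exact (conjugate_ne_self_of_isTotallyComplex z₀).symm
        rw [if_pos h, if_pos h, if_neg hne]
        norm_num
      · have hne : φ.comp j ≠ z₀ := by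
          rw [h]; exact conjugate_ne_self_of_isTotallyComplex z₀
        rw [if_neg hne, if_neg hne, if_pos h]
        norm_num
    · simp only [hφ, if_false, sub_zero]
  simp_rw [h1, h2]
  rw [Finset.sum_sub_distrib, Finset.sum_sub_distrib]
  congr 1
  exact Fintype.sum_equiv (Function.Involutive.toPerm _ (involutive_conjugate K)) _ _ fun t => by
    rw [Function.Involutive.coe_toPerm]

/-- The shadow itself (`δ = 1`) lies in its Hecke module. [folklore] -/
theorem shadow_mem_span_precomp_shadow {M : Type} [Field M] [NumberField M] (Φ : CMType K) (j : M →+* K) :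
    (fun z : M →+* ℂ => ∑ t ∈ Finset.univ.filter (fun t : K →+* ℂ => t.comp j = z), antiVec Φ.1 (1 : ℂ ≃+* ℂ) t) ∈
      Submodule.span ℚ (Set.range fun δ : M ≃ₐ[ℚ] M => fun z : M →+* ℂ =>
        ∑ t ∈ Finset.univ.filter (fun t : K →+* ℂ => t.comp j = z.comp (δ : M →+* M)), antiVec Φ.1 (1 : ℂ ≃+* ℂ) t) := by
  refine Submodule.subset_span ⟨1, funext fun z => ?_⟩
  have : z.comp ((1 : M ≃ₐ[ℚ] M) : M →+* M) = z := RingHom.ext fun _ => rfl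
  dsimp only
  rw [this]

/-- **`dim H = [W ≠ 0]`** for an imaginary quadratic pivot: the Hecke module of the shadow of `Φ` is the line `ℚ·w` if the
shadow at `z₀` (= the signature defect) is non-zero, and `0` otherwise. [cite: Deligne1982HodgeCycles, §4]
[cite: Gordon1999HodgeAVSurvey, 9.4.3] -/
theorem finrank_span_precomp_shadow_eq (hk : finrank ℚ k = 2) (Φ : CMType K) (j : k →+* K) (z₀ : k →+* ℂ) :
    Module.finrank ℚ (Submodule.span ℚ (Set.range fun δ : k ≃ₐ[ℚ] k => fun z : k →+* ℂ =>
        ∑ t ∈ Finset.univ.filter (fun t : K →+* ℂ => t.comp j = z.comp (δ : k →+* k)), antiVec Φ.1 (1 : ℂ ≃+* ℂ) t)) =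
      if ∑ t ∈ Finset.univ.filter (fun t : K →+* ℂ => t.comp j = z₀), antiVec Φ.1 (1 : ℂ ≃+* ℂ) t = 0 then 0 else 1 := by
  have hle := finrank_le_one_of_forall_apply_conjugate hk z₀ _
    (fun f hf z => apply_conjugate_eq_neg_of_mem_span_precomp_shadow Φ j hf z)
  split_ifs with h0
  · -- every generator vanishes at `z₀` (its value is `±W = 0`), is odd, hence is `0`
    rw [Submodule.finrank_eq_zero, Submodule.span_eq_bot]
    rintro _ ⟨δ, rfl⟩
    funext z
    rw [Pi.zero_apply]
    have hodd := fun z => (conjugate_comp z (δ : k →+* k)) ▸ shadow_conjugate Φ j (z.comp (δ : k →+* k))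
    have hval : ∀ z' : k →+* ℂ, ∑ t ∈ Finset.univ.filter (fun t : K →+* ℂ => t.comp j = z'),
        antiVec Φ.1 (1 : ℂ ≃+* ℂ) t = 0 := by
      intro z'
      rcases eq_or_eq_conjugate_of_finrank_eq_two' hk z₀ z' with rfl | rfl
      · exact h0
      · rw [shadow_conjugate, h0, neg_zero]
    exact hval _
  · refine le_antisymm hle ?_
    rw [Nat.one_le_iff_ne_zero, Ne, Submodule.finrank_eq_zero]
    intro hbot
    apply h0
    have hmem := shadow_mem_span_precomp_shadow (M := k) Φ j
    rw [hbot, Submodule.mem_bot] at hmem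
    exact congrFun hmem z₀

variable {I : Type} [Fintype I] {K' : I → Type} [∀ i, Field (K' i)] [∀ i, NumberField (K' i)]

omit [Field K] [NumberField K] in
/-- **`dim Σ_i H_i = [∃ i, W_i ≠ 0]`** for an imaginary quadratic pivot (all the Hecke modules lie in the one odd line).
[cite: Deligne1982HodgeCycles, §4] [cite: Gordon1999HodgeAVSurvey, 9.4.3] -/
theorem finrank_iSup_span_precomp_shadow_eq (hk : finrank ℚ k = 2) (Φ : ∀ i, CMType (K' i)) (j : ∀ i, k →+* K' i)
    (z₀ : k →+* ℂ) :
    Module.finrank ℚ (⨆ i, Submodule.span ℚ (Set.range fun δ : k ≃ₐ[ℚ] k => fun z : k →+* ℂ =>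
        ∑ t ∈ Finset.univ.filter (fun t : K' i →+* ℂ => t.comp (j i) = z.comp (δ : k →+* k)),
          antiVec (Φ i).1 (1 : ℂ ≃+* ℂ) t) : Submodule ℚ ((k →+* ℂ) → ℚ)) =
      if ∀ i, ∑ t ∈ Finset.univ.filter (fun t : K' i →+* ℂ => t.comp (j i) = z₀), antiVec (Φ i).1 (1 : ℂ ≃+* ℂ) t = 0
      then 0 else 1 := by
  have hle := finrank_le_one_of_forall_apply_conjugate hk z₀ _
    (fun f hf z => apply_conjugate_eq_neg_of_mem_iSup_span_precomp_shadow Φ j hf z)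
  split_ifs with h0
  · rw [Submodule.finrank_eq_zero, iSup_eq_bot]
    intro i
    rw [← Submodule.finrank_eq_zero, finrank_span_precomp_shadow_eq hk (Φ i) (j i) z₀, if_pos (h0 i)]
  · refine le_antisymm hle ?_
    push Not at h0
    obtain ⟨i, hi⟩ := h0
    have h1 : Module.finrank ℚ (Submodule.span ℚ (Set.range fun δ : k ≃ₐ[ℚ] k => fun z : k →+* ℂ =>
        ∑ t ∈ Finset.univ.filter (fun t : K' i →+* ℂ => t.comp (j i) = z.comp (δ : k →+* k)),
          antiVec (Φ i).1 (1 : ℂ ≃+* ℂ) t)) = 1 := by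
      rw [finrank_span_precomp_shadow_eq hk (Φ i) (j i) z₀, if_neg hi]
    rw [← h1]
    exact Submodule.finrank_mono (le_iSup (fun i => Submodule.span ℚ (Set.range fun δ : k ≃ₐ[ℚ] k =>
      fun z : k →+* ℂ => ∑ t ∈ Finset.univ.filter (fun t : K' i →+* ℂ => t.comp (j i) = z.comp (δ : k →+* k)),
        antiVec (Φ i).1 (1 : ℂ ≃+* ℂ) t)) i)

end Quadratic

/-! ### §3 The exact counts -/

section Counts

variable {I : Type} [Fintype I] {K : I → Type} [∀ i, Field (K i)] [∀ i, NumberField (K i)] [∀ i, IsCMField (K i)]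
  {k : Type} [Field k] [NumberField k] [IsTotallyComplex k]

omit [IsTotallyComplex k] in
/-- An imaginary quadratic field is Galois over `ℚ`. [folklore] -/
theorem isGalois_of_finrank_eq_two (hk : finrank ℚ k = 2) : IsGalois ℚ k := by
  haveI : Algebra.IsQuadraticExtension ℚ k := ⟨hk⟩
  haveI : Normal ℚ k := inferInstance
  exact ⟨⟩

/-- **TWO CM FIELDS OVER A COMMON IMAGINARY QUADRATIC FIELD: the drop is exactly `[W₀ ≠ 0 ∧ W₁ ≠ 0]`.**  `I = {i₀, i₁}`,
`j_κ : k → K_{i_κ}`, `[k:ℚ] = 2`, `k` totally complex, the Galois closures meeting inside `z₀(k)`.  Then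
`cmTypeRank Φ₀ + cmTypeRank Φ₁ = cmFamilyRank Φ + 1 + [W₀ ≠ 0 ∧ W₁ ≠ 0]` with `W_κ = Σ_{t | t∘j_κ = z₀} u_1(Φ_κ)(t)` the
signature defects: **`dim Hg(A₀) + dim Hg(A₁) − dim Hg(A₀ × A₁) = 1` if both defects are non-zero, `= 0` otherwise.**
[cite: MoonenZarhin1999LowDim, Thm. (0.1) (a) and §3 (3.1)] [cite: Deligne1982HodgeCycles, §4]
[cite: Gordon1999HodgeAVSurvey, §3 Theorem (proof), 7.5–7.7 and 9.4.3] -/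
theorem cmTypeRank_add_cmTypeRank_eq_of_quadratic (hk : finrank ℚ k = 2) {i₀ i₁ : I} (h01 : i₀ ≠ i₁)
    (hI : ∀ l, l = i₀ ∨ l = i₁) (Φ : ∀ i, CMType (K i)) (j₀ : k →+* K i₀) (j₁ : k →+* K i₁) (z₀ : k →+* ℂ)
    (hmeet : ∀ z : ℂ, z ∈ normalClosure ℚ (K i₀) ℂ → z ∈ normalClosure ℚ (K i₁) ℂ → z ∈ Set.range z₀) :
    cmTypeRank (Φ i₀) + cmTypeRank (Φ i₁) = CMAlgebra.cmFamilyRank Φ + 1 +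
      if (∑ t ∈ Finset.univ.filter (fun t : K i₀ →+* ℂ => t.comp j₀ = z₀), antiVec (Φ i₀).1 (1 : ℂ ≃+* ℂ) t ≠ 0) ∧
          (∑ t ∈ Finset.univ.filter (fun t : K i₁ →+* ℂ => t.comp j₁ = z₀), antiVec (Φ i₁).1 (1 : ℂ ≃+* ℂ) t ≠ 0)
      then 1 else 0 := by
  haveI := isGalois_of_finrank_eq_two hk
  rw [cmTypeRank_add_cmTypeRank_eq_cmFamilyRank_add_one_add_finrank_inf h01 hI Φ j₀ j₁ z₀ hmeet]
  congr 1
  -- the two Hecke modules and their sum lie in the odd line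
  have h0 := finrank_span_precomp_shadow_eq hk (Φ i₀) j₀ z₀
  have h1 := finrank_span_precomp_shadow_eq hk (Φ i₁) j₁ z₀
  have hsup := Submodule.finrank_sup_add_finrank_inf_eq
    (Submodule.span ℚ (Set.range fun δ : k ≃ₐ[ℚ] k => fun z : k →+* ℂ =>
      ∑ t ∈ Finset.univ.filter (fun t : K i₀ →+* ℂ => t.comp j₀ = z.comp (δ : k →+* k)), antiVec (Φ i₀).1 (1 : ℂ ≃+* ℂ) t))
    (Submodule.span ℚ (Set.range fun δ : k ≃ₐ[ℚ] k => fun z : k →+* ℂ =>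
      ∑ t ∈ Finset.univ.filter (fun t : K i₁ →+* ℂ => t.comp j₁ = z.comp (δ : k →+* k)), antiVec (Φ i₁).1 (1 : ℂ ≃+* ℂ) t))
  have hsuple : Module.finrank ℚ ↥(Submodule.span ℚ (Set.range fun δ : k ≃ₐ[ℚ] k => fun z : k →+* ℂ =>
      ∑ t ∈ Finset.univ.filter (fun t : K i₀ →+* ℂ => t.comp j₀ = z.comp (δ : k →+* k)), antiVec (Φ i₀).1 (1 : ℂ ≃+* ℂ) t) ⊔
      Submodule.span ℚ (Set.range fun δ : k ≃ₐ[ℚ] k => fun z : k →+* ℂ =>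
      ∑ t ∈ Finset.univ.filter (fun t : K i₁ →+* ℂ => t.comp j₁ = z.comp (δ : k →+* k)), antiVec (Φ i₁).1 (1 : ℂ ≃+* ℂ) t))
        ≤ 1 := by
    refine finrank_le_one_of_forall_apply_conjugate hk z₀ _ fun f hf z => ?_
    obtain ⟨f₀, hf₀, f₁, hf₁, rfl⟩ := Submodule.mem_sup.1 hf
    rw [Pi.add_apply, Pi.add_apply, apply_conjugate_eq_neg_of_mem_span_precomp_shadow (Φ i₀) j₀ hf₀ z,
      apply_conjugate_eq_neg_of_mem_span_precomp_shadow (Φ i₁) j₁ hf₁ z, neg_add]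
  have hinfle := Submodule.finrank_mono (inf_le_left :
    Submodule.span ℚ (Set.range fun δ : k ≃ₐ[ℚ] k => fun z : k →+* ℂ =>
      ∑ t ∈ Finset.univ.filter (fun t : K i₀ →+* ℂ => t.comp j₀ = z.comp (δ : k →+* k)), antiVec (Φ i₀).1 (1 : ℂ ≃+* ℂ) t) ⊓
      Submodule.span ℚ (Set.range fun δ : k ≃ₐ[ℚ] k => fun z : k →+* ℂ =>
      ∑ t ∈ Finset.univ.filter (fun t : K i₁ →+* ℂ => t.comp j₁ = z.comp (δ : k →+* k)), antiVec (Φ i₁).1 (1 : ℂ ≃+* ℂ) t)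
        ≤ _)
  have hsupge := Submodule.finrank_mono (le_sup_left :
    Submodule.span ℚ (Set.range fun δ : k ≃ₐ[ℚ] k => fun z : k →+* ℂ =>
      ∑ t ∈ Finset.univ.filter (fun t : K i₀ →+* ℂ => t.comp j₀ = z.comp (δ : k →+* k)), antiVec (Φ i₀).1 (1 : ℂ ≃+* ℂ) t)
        ≤ _ ⊔ Submodule.span ℚ (Set.range fun δ : k ≃ₐ[ℚ] k => fun z : k →+* ℂ =>
      ∑ t ∈ Finset.univ.filter (fun t : K i₁ →+* ℂ => t.comp j₁ = z.comp (δ : k →+* k)), antiVec (Φ i₁).1 (1 : ℂ ≃+* ℂ) t))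
  split_ifs at h0 with hA
  · rw [if_neg fun hC => hC.1 hA]
    omega
  · split_ifs at h1 with hB
    · rw [if_neg fun hC => hC.2 hB]
      omega
    · rw [if_pos ⟨hA, hB⟩]
      omega

/-- **A FAMILY OVER A COMMON IMAGINARY QUADRATIC FIELD: `Σ_i dim Hg(A_i) − dim Hg(∏_i A_i) = #{i : W_i ≠ 0} − [∃ i, W_i ≠ 0]`**
(hypothesis (GL): every Galois closure meets the compositum of the others inside `z₀(k)`): in additive form
`Σ_i cmTypeRank Φ_i + 1 + [∃ i, W_i ≠ 0] = cmFamilyRank Φ + |I| + #{i : W_i ≠ 0}` — every member of Weil type over `k` beyond the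
first lowers `dim Hg(∏A_i)` by exactly one. [cite: MoonenZarhin1999LowDim, §3 (3.1)] [cite: Deligne1982HodgeCycles, §4]
[cite: Gordon1999HodgeAVSurvey, 7.5–7.7 and 9.4.3] -/
theorem sum_cmTypeRank_add_one_add_eq_of_quadratic (hk : finrank ℚ k = 2) [Nonempty I] (Φ : ∀ i, CMType (K i))
    (j : ∀ i, k →+* K i) (z₀ : k →+* ℂ)
    (hmeet : ∀ (l : I) (z : ℂ), z ∈ normalClosure ℚ (K l) ℂ →
      z ∈ (⨆ i : {i : I // i ≠ l}, normalClosure ℚ (K i.1) ℂ) → z ∈ Set.range z₀) :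
    (∑ i, cmTypeRank (Φ i)) + 1 +
        (if ∃ i, ∑ t ∈ Finset.univ.filter (fun t : K i →+* ℂ => t.comp (j i) = z₀), antiVec (Φ i).1 (1 : ℂ ≃+* ℂ) t ≠ 0
          then 1 else 0) =
      CMAlgebra.cmFamilyRank Φ + Fintype.card I +
        (Finset.univ.filter fun i => ∑ t ∈ Finset.univ.filter (fun t : K i →+* ℂ => t.comp (j i) = z₀),
          antiVec (Φ i).1 (1 : ℂ ≃+* ℂ) t ≠ 0).card := by
  haveI := isGalois_of_finrank_eq_two hk
  have h := sum_cmTypeRank_add_one_add_finrank_iSup_eq Φ j z₀ hmeet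
  rw [finrank_iSup_span_precomp_shadow_eq hk Φ j z₀,
    Finset.sum_congr rfl fun i _ => finrank_span_precomp_shadow_eq hk (Φ i) (j i) z₀, Finset.sum_ite,
    Finset.sum_const_zero, zero_add, Finset.sum_const, smul_eq_mul, mul_one] at h
  rw [show (if ∃ i, ∑ t ∈ Finset.univ.filter (fun t : K i →+* ℂ => t.comp (j i) = z₀),
      antiVec (Φ i).1 (1 : ℂ ≃+* ℂ) t ≠ 0 then 1 else 0) =
      (if ∀ i, ∑ t ∈ Finset.univ.filter (fun t : K i →+* ℂ => t.comp (j i) = z₀),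
        antiVec (Φ i).1 (1 : ℂ ≃+* ℂ) t = 0 then 0 else 1) from by
    by_cases hall : ∀ i, ∑ t ∈ Finset.univ.filter (fun t : K i →+* ℂ => t.comp (j i) = z₀),
        antiVec (Φ i).1 (1 : ℂ ≃+* ℂ) t = 0
    · rw [if_pos hall, if_neg (by push Not; exact hall)]
    · rw [if_neg hall, if_pos (by push Not at hall; exact hall)]]
  convert h using 2

end Counts

end Summit.HodgeConjecture.CorCM

end
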